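import Summits.ABC.IUTFork.Cor312ThetaFiniteDHVolArch
import Summits.ABC.IUTFork.Cor312ThetaLocalDHVolArch
import Summits.ABC.IUTFork.Cor312BridgeHypsDHVolHullSets
import HarnessLib

/-!
# [IUTchIII] Corollary 3.12, statement — `BridgeHyps` and TEAM B's route for the real setting with the verbatim
# volumes AND an honest archimedean place (`Real.settingDHVolArch`)

Record-only file (D-0012) of the abc-iut cell (wave-5 prover seat abc-iut-w5-d163 gen 2; TEAM A row A-0 NAMED
LEFTOVER (4) «archimedean radial container vs DH convention», sequel of the chain `Cor312VolumesArchSummands` →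
`Cor312VolumesRealArch` → `Cor312VolumesArchLattice` → `Cor312SettingDHVolArch` → `Cor312HullDefinedDHVolArch` →
`Cor312ThetaLocalDHVolArch` / `Cor312ThetaFiniteDHVolArch`); TAKES NO SIDE on [IUTchIII] Cor. 3.12. The archimedean
twin of abc-iut-c312-5's `Cor312BridgeHypsDHVol` / `Cor312BridgeHypsDHVolHullSets` and of abc-iut-c312-6's
`Cor312SettingDHVolRoute`, read at `Real.settingDHVolArch` (c312-7's per-frame assembler over the real log-shells of
`F`; container = c312-5's VERBATIM one at every prime, abc-iut-L5-t7's radial/angular log-volume on `M_I` at `∞`,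
[IUTchIV] Prop. 1.5 (iii)/(iv), Thm. 1.10 Step (vii), kurims `paper:url-56bcb0f95768` p. 30):

* `thetaFinite_settingDHVolArch_of_container` — `ThetaFinite` with the `∞`-conditions in Step (vii) form (boxes inside
  the polydisc of radius `π^{j+1}` `= Φ₀(π^{j+1}·B_I)` and containing `Φ₀(⊗_i (π)_v)`);
* `adm_thetaRegion3_settingDHVolArch_inr` / `hfinθ_settingDHVolArch` — the (Ind3)-region at the primes (c312-5's
  arguments; the prime components of the two settings agree definitionally), finite support of its log-volume;
* **`bridgeHyps_settingDHVolArch_of_boxes`** — EVERY field of c312-6's `BridgeHyps (Real.settingDHVolArch …)` from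
  five transparent Θ-box conditions: (1) at every `(j ∈ 𝔽_l^⋇, ∞)` the union over `m` of the boxes IS the Step (vii)
  container `Φ₀(π^{j+1}·B_I)`; (2) at every prime it is a direct product over the summands of positive-finite-measure
  sets, (3) bounded and (4) nondegenerate; (5) it is `𝒪_L` off a finite prime set (`…_of_hullSets`: hull-set boxes);
* `logvolMono_settingDHVolArch` / `thetaRegionsAdm_settingDHVolArch_of_isHullSet` /
  `statement_settingDHVolArch_of_(global)VolumeTransport(_of_hullSets)` — TEAM B's route (c312-6) at this setting:
  the printed Statement from hull-set Θ-boxes + (`ThetaFinite` | the box conditions) + the B-INPUT (NOT asserted);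
[claim: Mochizuki2012, status: disputed] for the quoted sentences; the mathematics is classical.
Deliberately NOT here: the Θ-boxes of the genuine Θ-pilot object (binder), the B-INPUT, the non-vacuity witness
(sequel `Cor312ModelBoxesDHVolArch`), any judgement on Cor. 3.12.
-/

noncomputable section

open Set Function NumberField IsDedekindDomain Bornology
open scoped Pointwise

namespace Summit.ABC

namespace IUTFork

namespace Thm311

namespace Real

open Cor312 Cor312Vol Literature.IUT.LogThetaLattice Literature.IUT.LogVolume Literature.IUT.LogVolume.Prop15iii
  PiTensorProduct


variable {F : Type} [Field F] [NumberField F] (X : PilotData F) {logv : PadicLogs F} (hlog : LogvAnalytic logv)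
  (hc : ∀ w : InfinitePlace F, w.IsComplex)

section Setting

variable (M : Type) [Field M] [NumberField M]
  (archPk : ∀ (j : (thetaIndex X).Label) (vQ : (thetaIndex X).VQ), Set ((logShellsDH X logv).Packet j vQ))
  (archSub : ∀ (j : (thetaIndex X).Label) (v : (thetaIndex X).V),
    Set ((logShellsDH X logv).Packet j ((thetaIndex X).over v)))
  (Ψ : ℤ → ∀ v : (thetaIndex X).V, v ∈ (thetaIndex X).Vbad → Set ((logShellsDH X logv).StarPacket v))
  (act : ℤ → ∀ v : (thetaIndex X).V, v ∈ (thetaIndex X).Vbad →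
    (logShellsDH X logv).StarPacket v → Module.End ℚ ((logShellsDH X logv).StarPacket v))
  (Mmod : ℤ → ∀ j : (thetaIndex X).LabelStar, Set ((logShellsDH X logv).GlobalPacket j.1))
  (region : ℤ → ∀ j : (thetaIndex X).LabelStar, FinDivisor M → ∀ vQ : (thetaIndex X).VQ,
    Set ((logShellsDH X logv).Packet j.1 vQ))
  (n : ℤ) {HT : Type} {LogLink : HT → HT → Type} {IsFull : ∀ {s t : HT}, LogLink s t → Prop}
  (lat : LGPGaussianLogThetaLattice LogLink IsFull)
  {Frd : Type} {IsoF : Frd → Frd → Type} {Ob : Frd → Type} {realify : Frd → Frd} {Strip : Type}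
  {IsoS : Strip → Strip → Type} {Mv : ∀ v : (thetaIndex X).V, v ∈ (thetaIndex X).Vbad → Type}
  [∀ v h, Monoid (Mv v h)]
  (sig : GlobalLGPFrobenioidSignature (thetaIndex X).lstar (thetaIndex X).V (· ∈ (thetaIndex X).Vbad)
    Frd IsoF Ob realify Strip IsoS Mv)
  (split : SplittingMonoids Mv) {ObΔ : Type} {N : ∀ v : (thetaIndex X).V, v ∈ (thetaIndex X).Vbad → Type}
  [∀ v h, Monoid (N v h)] (qData : QPilotData ObΔ N)
  (thetaBox : ℤ → Ob sig.Clgp → ∀ (j : (thetaIndex X).Label) (vQ : (thetaIndex X).VQ),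
    Set (∀ s : factorIdxDHArch X hlog j vQ, factorFieldDHArch X hlog j vQ s))
  (qCentre : ObΔ → ∀ (j : (thetaIndex X).Label) (vQ : (thetaIndex X).VQ),
    ∀ s : factorIdxDHArch X hlog j vQ, factorFieldDHArch X hlog j vQ s)
  (hq : ∀ j vQ s, qCentre (qPilotObject qData) j vQ s ≠ 0)
  (hfin : ∀ j : (thetaIndex X).Label, (Function.support fun vQ =>
    ((situationDHVolArch X hlog hc M archPk archSub Ψ act Mmod region).D n).logvol j vQ
      (factorMapDHArch X hlog hc j vQ ⁻¹' hullSet (factorFieldDHArch X hlog j vQ)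
        (qCentre (qPilotObject qData) j vQ))).Finite)

/-! ## 0. `ThetaFinite` with the `∞`-conditions in Step (vii) form -/

variable {thetaBox} in
/-- **`ThetaFinite` with the `∞`-conditions in [IUTchIV] Step (vii) form**: at every `(j ∈ 𝔽_l^⋇, ∞)` the boxes lie
in the polydisc of radius `π^{j+1}` (`= Φ₀(π^{j+1}·B_I)`) and contain `Φ₀(⊗_i (π)_v)`; at the primes as in
`thetaFinite_settingDHVolArch`. [claim: Mochizuki2012, status: disputed] -/
theorem thetaFinite_settingDHVolArch_of_container
    (hsub : ∀ i : Fin (thetaIndex X).lstar,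
      (⋃ m : ℤ, thetaBox m (thetaPilotObject sig split) (Setting.labelSucc i) (.inl ())) ⊆
        archContainer X hlog (Setting.labelSucc i))
    (hmem : ∀ i : Fin (thetaIndex X).lstar, archMaxPoint X hlog (Setting.labelSucc i) ∈
      ⋃ m : ℤ, thetaBox m (thetaPilotObject sig split) (Setting.labelSucc i) (.inl ()))
    (hbdd : ∀ (i : Fin (thetaIndex X).lstar) (pp : Nat.Primes),
      IsBounded (⋃ m : ℤ, thetaBox m (thetaPilotObject sig split) (Setting.labelSucc i) (.inr pp)))
    (hnd : ∀ (i : Fin (thetaIndex X).lstar) (pp : Nat.Primes),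
      IsNondegenerate (factorFieldDHArch X hlog (Setting.labelSucc i) (.inr pp))
        (⋃ m : ℤ, thetaBox m (thetaPilotObject sig split) (Setting.labelSucc i) (.inr pp)))
    (hcof : ∀ i : Fin (thetaIndex X).lstar, {pp : Nat.Primes |
      (⋃ m : ℤ, thetaBox m (thetaPilotObject sig split) (Setting.labelSucc i) (.inr pp)) ≠
        hullSet (factorFieldDHArch X hlog (Setting.labelSucc i) (.inr pp)) (fun _ => 1)}.Finite) :
    (settingDHVolArch X hlog hc M archPk archSub Ψ act Mmod region n lat sig split qData thetaBox qCentre hq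
      hfin).ThetaFinite := by
  refine thetaFinite_settingDHVolArch X hlog hc M archPk archSub Ψ act Mmod region n lat sig split qData thetaBox
    qCentre hq hfin (fun i vQ => ?_) (fun i vQ => ?_) hcof
  · rcases vQ with u | pp
    · cases u
      exact (isBounded_polydisc _ _).subset (hsub i)
    · exact hbdd i pp
  · rcases vQ with u | pp
    · cases u
      exact fun s => ⟨_, hmem i, by
        rw [← norm_ne_zero_iff, norm_archMaxPoint]
        exact (pow_pos Real.pi_pos _).ne'⟩
    · exact hnd i pp

/-! ## 1. The (Ind3)-region at the primes; finite support of its log-volume -/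

/-- At a prime the (Ind3)-region is admissible in the verbatim container as soon as the union of the Θ-boxes is
(the image of) a DIRECT PRODUCT over the summands `v⃗` of sets of positive finite Haar measure ([IUTchIII] Rmk.
3.1.1 (iii) "direct product regions"); c312-5's argument at the archimedean-honest setting.
[claim: Mochizuki2012, status: disputed] -/
theorem adm_thetaRegion3_settingDHVolArch_inr (j : (thetaIndex X).Label) (pp : Nat.Primes)
    (hprod : haveI : Fact (pp : ℕ).Prime := ⟨pp.2⟩
      ∃ R : ∀ e : (thetaIndex X).Caps j → (thetaIndex X).Fibre (.inr pp), Set ((presAt X hlog pp).X e),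
        (∀ e, PacketAdm (pp : ℕ) ((presAt X hlog pp).kk e) (R e)) ∧
        (⋃ m : ℤ, thetaBox m (thetaPilotObject sig split) j (.inr pp)) =
          (presAt X hlog pp).factorCoords j '' Set.pi univ R) :
    ((situationDHVolArch X hlog hc M archPk archSub Ψ act Mmod region).D n).Adm j (.inr pp)
      ((settingDHVolArch X hlog hc M archPk archSub Ψ act Mmod region n lat sig split qData thetaBox qCentre hq
        hfin).thetaRegion3 j (.inr pp)) := by
  haveI : Fact (pp : ℕ).Prime := ⟨pp.2⟩
  obtain ⟨R, hR, hU⟩ := hprod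
  have hset : (settingDHVolArch X hlog hc M archPk archSub Ψ act Mmod region n lat sig split qData thetaBox qCentre
      hq hfin).thetaRegion3 j (.inr pp) = (presAt X hlog pp).comparison j ⁻¹' Set.pi univ R := by
    rw [thetaRegion3_settingDHVolArch]
    ext x
    have hx : factorMapDHArch X hlog hc j (.inr pp) x =
        (presAt X hlog pp).factorCoords j ((presAt X hlog pp).comparison j x) :=
      congrFun (factorMapDHArch_inr X hlog hc j pp) x
    constructor
    · intro h
      have h' : factorMapDHArch X hlog hc j (.inr pp) x ∈ (presAt X hlog pp).factorCoords j '' Set.pi univ R :=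
        hU ▸ h
      obtain ⟨y, hy, hyx⟩ := h'
      have hy' : y = (presAt X hlog pp).comparison j x :=
        (presAt X hlog pp).factorCoords_injective j (hyx.trans hx)
      show (presAt X hlog pp).comparison j x ∈ Set.pi univ R
      rw [← hy']
      exact hy
    · intro h
      have h' : factorMapDHArch X hlog hc j (.inr pp) x ∈ (presAt X hlog pp).factorCoords j '' Set.pi univ R :=
        ⟨_, h, hx.symm⟩
      show factorMapDHArch X hlog hc j (.inr pp) x ∈ ⋃ m : ℤ, thetaBox m (thetaPilotObject sig split) j (.inr pp)
      rw [hU]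
      exact h'
  rw [hset]
  exact ⟨R, Set.image_preimage_eq _ ((presAt X hlog pp).comparison_surjective j), hR⟩

/-- Where the union of the Θ-boxes is the unit polydisc, the (Ind3)-region is `e⁻¹(Π_{v⃗} (R_{v⃗})^∼)`, of
log-volume `0`. [claim: Mochizuki2012, status: disputed] -/
theorem logvol_thetaRegion3_settingDHVolArch_eq_zero_of_box (j : (thetaIndex X).Label) (pp : Nat.Primes)
    (hbox : (⋃ m : ℤ, thetaBox m (thetaPilotObject sig split) j (.inr pp)) =
      hullSet (factorFieldDHArch X hlog j (.inr pp)) (fun _ => 1)) :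
    ((situationDHVolArch X hlog hc M archPk archSub Ψ act Mmod region).D n).logvol j (.inr pp)
      ((settingDHVolArch X hlog hc M archPk archSub Ψ act Mmod region n lat sig split qData thetaBox qCentre hq
        hfin).thetaRegion3 j (.inr pp)) = 0 := by
  rw [thetaRegion3_settingDHVolArch, hbox, preimage_factorMapDHArch_hullSet_one X hlog hc j pp]
  exact logvol_preimage_normalizedPacket_settingDHVolArch X hlog hc M archPk archSub Ψ act Mmod region n j pp

/-- **Finite support of the (Ind3)-region's log-volume** (`hfinθ` of `bridgeHyps_settingDHVolArch`) from "boxes =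
unit polydisc off a finite prime set" (the archimedean place is ONE place, whatever its term).
[claim: Mochizuki2012, status: disputed] -/
theorem hfinθ_settingDHVolArch (i : Fin (thetaIndex X).lstar)
    (hcof : {pp : Nat.Primes |
      (⋃ m : ℤ, thetaBox m (thetaPilotObject sig split) (Setting.labelSucc i) (.inr pp)) ≠
        hullSet (factorFieldDHArch X hlog (Setting.labelSucc i) (.inr pp)) (fun _ => 1)}.Finite) :
    (Function.support fun vQ : (thetaIndex X).VQ =>
      ((situationDHVolArch X hlog hc M archPk archSub Ψ act Mmod region).D n).logvol _ vQ
        ((settingDHVolArch X hlog hc M archPk archSub Ψ act Mmod region n lat sig split qData thetaBox qCentre hq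
          hfin).thetaRegion3 (Setting.labelSucc i) vQ)).Finite := by
  refine ((Set.finite_range Sum.inl).union (hcof.image Sum.inr)).subset ?_
  intro vQ hvQ
  rcases vQ with u | pp
  · exact Or.inl ⟨u, rfl⟩
  · refine Or.inr ⟨pp, ?_, rfl⟩
    by_contra hpp
    simp only [Set.mem_setOf_eq, ne_eq, not_not] at hpp
    exact hvQ (logvol_thetaRegion3_settingDHVolArch_eq_zero_of_box X hlog hc M archPk archSub Ψ act Mmod region n
      lat sig split qData thetaBox qCentre hq hfin _ pp hpp)

/-! ## 2. `BridgeHyps` from the Θ-box conditions -/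

variable {thetaBox} in
/-- **c312-6's `BridgeHyps` for the real setting with the verbatim volumes and an HONEST archimedean place — EVERY
field discharged — from five transparent conditions on the Θ-boxes of the Θ-pilot object**: (1) at every
`(j ∈ 𝔽_l^⋇, ∞)` the union over `m` of the boxes is the Step (vii) container (the polydisc of radius `π^{j+1}`,
`= Φ₀(π^{j+1}·B_I)`); (2) at every prime it is a direct product over the summands of positive-finite-measure sets,
(3) bounded (Dupuy–Hilado (4.10)) and (4) nondegenerate; (5) it is the unit polydisc `𝒪_L` off a finite prime set.
[claim: Mochizuki2012, status: disputed] -/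
theorem bridgeHyps_settingDHVolArch_of_boxes
    (heq : ∀ i : Fin (thetaIndex X).lstar,
      (⋃ m : ℤ, thetaBox m (thetaPilotObject sig split) (Setting.labelSucc i) (.inl ())) =
        archContainer X hlog (Setting.labelSucc i))
    (hprod : ∀ (i : Fin (thetaIndex X).lstar) (pp : Nat.Primes), haveI : Fact (pp : ℕ).Prime := ⟨pp.2⟩
      ∃ R : ∀ e : (thetaIndex X).Caps (Setting.labelSucc i) → (thetaIndex X).Fibre (.inr pp),
          Set ((presAt X hlog pp).X e),
        (∀ e, PacketAdm (pp : ℕ) ((presAt X hlog pp).kk e) (R e)) ∧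
        (⋃ m : ℤ, thetaBox m (thetaPilotObject sig split) (Setting.labelSucc i) (.inr pp)) =
          (presAt X hlog pp).factorCoords (Setting.labelSucc i) '' Set.pi univ R)
    (hbdd : ∀ (i : Fin (thetaIndex X).lstar) (pp : Nat.Primes),
      IsBounded (⋃ m : ℤ, thetaBox m (thetaPilotObject sig split) (Setting.labelSucc i) (.inr pp)))
    (hnd : ∀ (i : Fin (thetaIndex X).lstar) (pp : Nat.Primes),
      IsNondegenerate (factorFieldDHArch X hlog (Setting.labelSucc i) (.inr pp))
        (⋃ m : ℤ, thetaBox m (thetaPilotObject sig split) (Setting.labelSucc i) (.inr pp)))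
    (hcof : ∀ i : Fin (thetaIndex X).lstar, {pp : Nat.Primes |
      (⋃ m : ℤ, thetaBox m (thetaPilotObject sig split) (Setting.labelSucc i) (.inr pp)) ≠
        hullSet (factorFieldDHArch X hlog (Setting.labelSucc i) (.inr pp)) (fun _ => 1)}.Finite) :
    BridgeHyps (settingDHVolArch X hlog hc M archPk archSub Ψ act Mmod region n lat sig split qData thetaBox
      qCentre hq hfin) :=
  bridgeHyps_settingDHVolArch X hlog hc M archPk archSub Ψ act Mmod region n lat sig split qData thetaBox qCentre hq
    hfin
    (fun i vQ => by
      rcases vQ with u | pp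
      · cases u
        exact adm_thetaRegion3_settingDHVolArch_inl_of_eq X hlog hc M archPk archSub Ψ act Mmod region n lat sig
          split qData qCentre hq hfin _ (heq i)
      · exact adm_thetaRegion3_settingDHVolArch_inr X hlog hc M archPk archSub Ψ act Mmod region n lat sig split
          qData thetaBox qCentre hq hfin _ pp (hprod i pp))
    (fun i => hfinθ_settingDHVolArch X hlog hc M archPk archSub Ψ act Mmod region n lat sig split qData thetaBox
      qCentre hq hfin i (hcof i))
    (thetaFinite_settingDHVolArch_of_container X hlog hc M archPk archSub Ψ act Mmod region n lat sig split qData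
      qCentre hq hfin (fun i => (heq i).le)
      (fun i => by
        rw [heq i]
        exact (mem_polydisc _).2 fun s => (norm_archMaxPoint X hlog _ s).le)
      hbdd hnd hcof)

variable {thetaBox} in
/-- **`BridgeHyps` when the Θ-boxes at the primes are hull-sets `λ_Θ·𝒪_L`** ([IUTchIII] Rmk. 3.9.5 (vii) (Ob1); the
shape delivered by abc-iut-c312-3's `Cor312PilotIdelesHull`): container boxes at `∞`, hull-set unions at every
`(j ∈ 𝔽_l^⋇, p)`, `= 𝒪_L` off a finite prime set (c312-5 `hprod_of_isHullSet`). [claim: Mochizuki2012, status: disputed] -/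
theorem bridgeHyps_settingDHVolArch_of_hullSets
    (heq : ∀ i : Fin (thetaIndex X).lstar,
      (⋃ m : ℤ, thetaBox m (thetaPilotObject sig split) (Setting.labelSucc i) (.inl ())) =
        archContainer X hlog (Setting.labelSucc i))
    (hhul : ∀ (i : Fin (thetaIndex X).lstar) (pp : Nat.Primes),
      IsHullSet (factorFieldDHArch X hlog (Setting.labelSucc i) (.inr pp))
        (⋃ m : ℤ, thetaBox m (thetaPilotObject sig split) (Setting.labelSucc i) (.inr pp)))
    (hcof : ∀ i : Fin (thetaIndex X).lstar, {pp : Nat.Primes |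
      (⋃ m : ℤ, thetaBox m (thetaPilotObject sig split) (Setting.labelSucc i) (.inr pp)) ≠
        hullSet (factorFieldDHArch X hlog (Setting.labelSucc i) (.inr pp)) (fun _ => 1)}.Finite) :
    BridgeHyps (settingDHVolArch X hlog hc M archPk archSub Ψ act Mmod region n lat sig split qData thetaBox
      qCentre hq hfin) :=
  bridgeHyps_settingDHVolArch_of_boxes X hlog hc M archPk archSub Ψ act Mmod region n lat sig split qData qCentre hq
    hfin heq (fun i pp => hprod_of_isHullSet X hlog (Setting.labelSucc i) pp (hhul i pp))
    (fun i pp => (hhul i pp).isBounded) (fun i pp => (hhul i pp).isNondegenerate) hcof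

/-! ## 3. TEAM B's route at this setting: `Statement ⟸ (Global)VolumeTransport` -/

/-- **`LogvolMono` PROVED for the archimedean-honest real setting** ([IUTchIII] Prop. 3.9 (i): nonnegative weights,
factorwise monotone log-measures — at `∞` L5-t7's `nlogVol_mono`; c312-5 `SummandPieces.logvolMono_of_realizes`).
[claim: Mochizuki2012, status: disputed] -/
theorem logvolMono_settingDHVolArch :
    LogvolMono (settingDHVolArch X hlog hc M archPk archSub Ψ act Mmod region n lat sig split qData thetaBox qCentre
      hq hfin) :=
  SummandPieces.logvolMono_of_realizes (realizes_situationDHVolArch X hlog hc M archPk archSub Ψ act Mmod region _)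

/-- **`ThetaRegionsAdm` from hull-set Θ-boxes** (every Kummer image `λ·𝒪_L` is admissible — at `∞` too, where
`e⁻¹(λ·𝒪_L)` is the preimage of a polydisc of POSITIVE radii: p420611 `hadm_DHArch`). [claim: Mochizuki2012, status: disputed] -/
theorem thetaRegionsAdm_settingDHVolArch_of_isHullSet
    (hbox : ∀ (m : ℤ) (i : Fin (thetaIndex X).lstar) (vQ : (thetaIndex X).VQ),
      IsHullSet (factorFieldDHArch X hlog _ vQ) (thetaBox m (thetaPilotObject sig split) (Setting.labelSucc i) vQ)) :
    ThetaRegionsAdm (settingDHVolArch X hlog hc M archPk archSub Ψ act Mmod region n lat sig split qData thetaBox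
      qCentre hq hfin) :=
  fun m i vQ => hadm_DHArch X hlog hc M archPk archSub Ψ act Mmod region n _ vQ _ (hbox m i vQ)

/-- **THE PRINTED STATEMENT OF [IUTchIII] COR. 3.12 AT `Real.settingDHVolArch`** from exactly: (1) hull-set Θ-boxes
(shape of the binder), (2) `ThetaFinite`, (3) the per-packet B-INPUT `VolumeTransport` (GAP-LEDGER G-c312-11-1
family — NOT asserted). `LogvolMono` and `hadm` are PROVED here. [claim: Mochizuki2012, status: disputed] -/
theorem statement_settingDHVolArch_of_volumeTransport
    (hbox : ∀ (m : ℤ) (i : Fin (thetaIndex X).lstar) (vQ : (thetaIndex X).VQ),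
      IsHullSet (factorFieldDHArch X hlog _ vQ) (thetaBox m (thetaPilotObject sig split) (Setting.labelSucc i) vQ))
    (finite : (settingDHVolArch X hlog hc M archPk archSub Ψ act Mmod region n lat sig split qData thetaBox qCentre
      hq hfin).ThetaFinite)
    (hvt : VolumeTransport (settingDHVolArch X hlog hc M archPk archSub Ψ act Mmod region n lat sig split qData
      thetaBox qCentre hq hfin)) :
    (settingDHVolArch X hlog hc M archPk archSub Ψ act Mmod region n lat sig split qData thetaBox qCentre hq
      hfin).Statement :=
  statement_of_volumeTransport_of_mono
    (logvolMono_settingDHVolArch X hlog hc M archPk archSub Ψ act Mmod region n lat sig split qData thetaBox qCentre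
      hq hfin) finite
    (thetaRegionsAdm_settingDHVolArch_of_isHullSet X hlog hc M archPk archSub Ψ act Mmod region n lat sig split qData
      thetaBox qCentre hq hfin hbox) hvt

/-- … from the GLOBAL B-INPUT `GlobalVolumeTransport` (B1's (G1′)-admissible quantifier level).
[claim: Mochizuki2012, status: disputed] -/
theorem statement_settingDHVolArch_of_globalVolumeTransport
    (hbox : ∀ (m : ℤ) (i : Fin (thetaIndex X).lstar) (vQ : (thetaIndex X).VQ),
      IsHullSet (factorFieldDHArch X hlog _ vQ) (thetaBox m (thetaPilotObject sig split) (Setting.labelSucc i) vQ))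
    (finite : (settingDHVolArch X hlog hc M archPk archSub Ψ act Mmod region n lat sig split qData thetaBox qCentre
      hq hfin).ThetaFinite)
    (hgvt : GlobalVolumeTransport (settingDHVolArch X hlog hc M archPk archSub Ψ act Mmod region n lat sig split qData
      thetaBox qCentre hq hfin)) :
    (settingDHVolArch X hlog hc M archPk archSub Ψ act Mmod region n lat sig split qData thetaBox qCentre hq
      hfin).Statement :=
  statement_of_globalVolumeTransport_of_mono
    (logvolMono_settingDHVolArch X hlog hc M archPk archSub Ψ act Mmod region n lat sig split qData thetaBox qCentre
      hq hfin) finite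
    (thetaRegionsAdm_settingDHVolArch_of_isHullSet X hlog hc M archPk archSub Ψ act Mmod region n lat sig split qData
      thetaBox qCentre hq hfin hbox) hgvt

variable {thetaBox} in
/-- **… with `ThetaFinite` DISCHARGED by the box conditions**: hull-set boxes everywhere, container unions at `∞`,
`𝒪_L` unions off a finite prime set, and the GLOBAL B-INPUT. [claim: Mochizuki2012, status: disputed] -/
theorem statement_settingDHVolArch_of_globalVolumeTransport_of_hullSets
    (hboxm : ∀ (m : ℤ) (i : Fin (thetaIndex X).lstar) (vQ : (thetaIndex X).VQ),
      IsHullSet (factorFieldDHArch X hlog _ vQ) (thetaBox m (thetaPilotObject sig split) (Setting.labelSucc i) vQ))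
    (heq : ∀ i : Fin (thetaIndex X).lstar,
      (⋃ m : ℤ, thetaBox m (thetaPilotObject sig split) (Setting.labelSucc i) (.inl ())) =
        archContainer X hlog (Setting.labelSucc i))
    (hhul : ∀ (i : Fin (thetaIndex X).lstar) (pp : Nat.Primes),
      IsHullSet (factorFieldDHArch X hlog (Setting.labelSucc i) (.inr pp))
        (⋃ m : ℤ, thetaBox m (thetaPilotObject sig split) (Setting.labelSucc i) (.inr pp)))
    (hcof : ∀ i : Fin (thetaIndex X).lstar, {pp : Nat.Primes |
      (⋃ m : ℤ, thetaBox m (thetaPilotObject sig split) (Setting.labelSucc i) (.inr pp)) ≠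
        hullSet (factorFieldDHArch X hlog (Setting.labelSucc i) (.inr pp)) (fun _ => 1)}.Finite)
    (hgvt : GlobalVolumeTransport (settingDHVolArch X hlog hc M archPk archSub Ψ act Mmod region n lat sig split qData
      thetaBox qCentre hq hfin)) :
    (settingDHVolArch X hlog hc M archPk archSub Ψ act Mmod region n lat sig split qData thetaBox qCentre hq
      hfin).Statement :=
  statement_settingDHVolArch_of_globalVolumeTransport X hlog hc M archPk archSub Ψ act Mmod region n lat sig split
    qData thetaBox qCentre hq hfin hboxm
    (thetaFinite_settingDHVolArch_of_container X hlog hc M archPk archSub Ψ act Mmod region n lat sig split qData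
      qCentre hq hfin (fun i => (heq i).le)
      (fun i => by
        rw [heq i]
        exact (mem_polydisc _).2 fun s => (norm_archMaxPoint X hlog _ s).le)
      (fun i pp => (hhul i pp).isBounded) (fun i pp => (hhul i pp).isNondegenerate) hcof)
    hgvt

end Setting

end Real

end Thm311

end IUTFork

end Summit.ABC

end
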